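/-
Copyright (c) 2026. All rights reserved.
Released under Apache 2.0 license as described in the file LICENSE.
Authors: abc-iut cell, statement-typer seat abc-iut-L4-t9 (wave 2, block W2-B2).
-/
import Literature.AnabelianGeometry.AbsoluteAnabelian.AugmentedCores
import Literature.AnabelianGeometry.AbsoluteAnabelian.AbsTopIII.BiAnabelianTelecore
import Literature.AnabelianGeometry.AbsoluteAnabelian.AbsTopIII.BiAnabelianDiagramsProofs

/-!
# [AbsTopIII] Corollary 3.7 (i) and (ii), last sentence — PROOFS: `𝔈` forms a core of `𝒟†` and of `𝒟*`

S. Mochizuki, *Topics in absolute anabelian geometry III* [MochizukiAbsTopIII2015] (manuscript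
`paper:url-5493eb38cbb7`), Cor 3.7 (i) p. 87: "`𝒟† = 𝒟†_{≤4}` [...] admits a natural structure of
core on `𝒟†_{≤3}` [...]. That is to say, loosely speaking, `𝔈` 'forms a core' of the functors in
`𝒟†`" (the elided "(respectively, `𝒟‡_{≤1}`)" / "(respectively, `𝒟†_{≤1}`)" half is
`refCoreStmt_holds` of `BiAnabelianDiagramsProofs.lean`); Cor 3.7 (ii) p. 88: "`𝒟* = 𝒟*_{≤4}`
admits a natural structure of core on `𝒟*_{≤3}` [...] loosely speaking, `𝔈` 'forms a core' of the
functors in `𝒟*`"; proof p. 88 / p. 80: "immediate from the definitions".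

Proof-only companion of `BiAnabelianDiagrams.lean` / `BiAnabelianTelecore.lean` (no new statements):
for EVERY setting `𝔖 : BiAnabelianSetting X E N` we DISCHARGE `GaloisCoreStmt`, hence `Cor_3_7_i`
(with `refCoreStmt_holds` of `BiAnabelianDiagramsProofs.lean` for the second half), and
`StarGaloisCoreStmt`. The core structures are the ones induced — via `AugmentedCores.lean`
(`CoreAugmentation`, `coreObservable`, `coreObservable_isCore`: an augmentation towards the
observation category makes an observable a core; abc-iut-L4-t5's `DiagramCores.lean` `OverData` is
the same device) — by the evident AUGMENTATION of `𝒟*` towards `𝔈`: `pr ⋙ gal` on the copies of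
`𝒳 ×_𝔈 𝒳`, `gal` at `□` and at the core vertex, `𝒩 → 𝔈` at `𝒩`, the identity at `𝔈`; the edge
2-cells are `log ⋙ gal ≅ gal` (from `log ≅ 𝟭`), `λ^× ⋙ (𝒩 → 𝔈) ≅ gal`, `λ^{×pf} ⋙ (𝒩 → 𝔈) ≅ gal`
(the setting's `lamTimesGal`, `lamTimesPfGal`), the structure 2-cell of the fibre square for `π_⋎`,
and identities. Nothing here bears on [IUTchIII] Cor. 3.12.
-/

set_option autoImplicit false

namespace Literature.AnabelianGeometry.AbsoluteAnabelian.AbsTopIII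

open CategoryTheory Quiver DiagramOfCategories

universe u

namespace BiAnabelianSetting

variable {X E N : Type u} [Category.{u} X] [Category.{u} E] [Category.{u} N]
  (𝔖 : BiAnabelianSetting X E N)

/-! ## The augmentation of `𝒟*` towards `𝔈` -/

/-- The augmentation functor at each vertex of `𝒟*`: `pr ⋙ gal` on row 1, `gal` at `□` and at the core
vertex, `𝒩 → 𝔈` at `𝒩`, the identity at `𝔈`. [cite: MochizukiAbsTopIII2015, Cor 3.7 (i) p.87] -/
def starAug : ∀ a : Cor37Vertex, 𝔖.starDiagram.obj a ⥤ E
  | .first _ => 𝔖.pr ⋙ 𝔖.gal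
  | .box => 𝔖.gal
  | .space => 𝔖.spaceGal
  | .galois => 𝟭 E
  | .ref => 𝔖.gal

/-- The edge 2-cells of the augmentation ("the Galois group is undisturbed"): `log_𝒳 ⋙ pr ⋙ gal =
pr ⋙ log ⋙ gal ≅ pr ⋙ gal`, `λ^× ⋙ (𝒩 → 𝔈) ≅ gal`, `λ^{×pf} ⋙ (𝒩 → 𝔈) ≅ gal`, `π ⋙ gal ≅ pr ⋙ gal` (the
structure 2-cell of `𝒳 ×_𝔈 𝒳`), identities elsewhere. [cite: MochizukiAbsTopIII2015, Cor 3.7 (i) p.87] -/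
def starAugIso : ∀ {a b : Cor37Vertex} (e : Cor37Edge.{u} a b),
    𝔖.starDiagram.map e ⋙ 𝔖.starAug b ≅ 𝔖.starAug a
  | _, _, .log _ _ _ => Functor.isoWhiskerLeft 𝔖.pr 𝔖.logGal
  | _, _, .pr _ => Iso.refl _
  | _, _, .lamTimes => 𝔖.lamTimesGal
  | _, _, .lamTimesPf => 𝔖.lamTimesPfGal
  | _, _, .toGal => 𝔖.spaceGal.rightUnitor
  | _, _, .proj _ => (FiberSquare.prCompIsoSndComp 𝔖.gal).symm
  | _, _, .diag _ => Iso.refl _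
  | _, _, .diagBox => 𝔖.gal.leftUnitor

/-! ## Cor 3.7 (i): `𝔈` forms a core of `𝒟†` -/

/-- The augmentation of `𝒟†_{≤3}` towards `𝔈` (restriction of `starAug`) as a `CoreAugmentation` of
the extension datum `(𝒟†_{≤4}, 𝔈)`. [cite: MochizukiAbsTopIII2015, Cor 3.7 (i) p.87] -/
def galCoreAugmentation : (𝔖.daggerLe 3).CoreAugmentation 𝔖.galCoreExt where
  isEmpty_J _ := inferInstanceAs (IsEmpty PEmpty)
  aug a := 𝔖.starAug a.1
  iso e := 𝔖.starAugIso e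
  obsIso {a} i := match a, i with
    | ⟨.space, _⟩, _ => Iso.refl _
    | ⟨.first _, _⟩, i => PEmpty.elim i
    | ⟨.box, _⟩, i => PEmpty.elim i
    | ⟨.galois, _⟩, i => PEmpty.elim i
    | ⟨.ref, _⟩, i => PEmpty.elim i

/-- Every vertex of `𝒟†_{≤3}` reaches `𝔈` (`⋎ → □ → 𝒩 → 𝔈`). [cite: MochizukiAbsTopIII2015, Cor 3.7 (i) p.87] -/
theorem galCore_reaches (a : SubVertex {a : Cor37Vertex | a.InDaggerLe 3}) :
    Nonempty (Path (galCoreShape.{u}.base a) galCoreShape.{u}.obs) := by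
  obtain ⟨a, ha⟩ := a
  have hbox : Cor37Vertex.box.InDaggerLe 3 := Cor37Vertex.box_inDaggerLe (by decide)
  have hsp : Cor37Vertex.space.InDaggerLe 3 := Cor37Vertex.space_inDaggerLe le_rfl
  have tail : Path (galCoreShape.{u}.base ⟨.box, hbox⟩) galCoreShape.{u}.obs :=
    ((Path.nil : Path (galCoreShape.{u}.base ⟨.box, hbox⟩) _).cons
      (show galCoreShape.{u}.base ⟨.box, hbox⟩ ⟶ galCoreShape.{u}.base ⟨.space, hsp⟩
        from Cor37Edge.lamTimes)).cons
      (show galCoreShape.{u}.base ⟨.space, hsp⟩ ⟶ galCoreShape.{u}.obs from PUnit.unit)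
  cases a with
  | first n =>
    exact ⟨((Path.nil : Path (galCoreShape.{u}.base ⟨.first n, ha⟩) _).cons
      (show galCoreShape.{u}.base ⟨.first n, ha⟩ ⟶ galCoreShape.{u}.base ⟨.box, hbox⟩
        from Cor37Edge.pr n)).comp tail⟩
  | box => exact ⟨tail⟩
  | space => exact ⟨(Path.nil : Path (galCoreShape.{u}.base ⟨.space, ha⟩) _).cons
      (show galCoreShape.{u}.base ⟨.space, ha⟩ ⟶ galCoreShape.{u}.obs from PUnit.unit)⟩
  | galois => exact False.elim (by simpa [Cor37Vertex.row] using ha.2)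
  | ref => exact False.elim (ha.1 rfl)

/-- **Cor 3.7 (i), first half, DISCHARGED** for every setting: "`𝔈` 'forms a core' of the functors
in `𝒟†`" — the core structure induced by the augmentation. [cite: MochizukiAbsTopIII2015, Cor 3.7 (i) p.87] -/
theorem galoisCoreStmt_holds : 𝔖.GaloisCoreStmt :=
  ⟨𝔖.galCoreAugmentation.coreFamily, 𝔖.galCoreAugmentation.coreFamily_terminal,
    𝔖.galCoreAugmentation.coreObservable_isCore galCore_reaches⟩

/-- **Cor 3.7 (i) DISCHARGED** for every setting (both halves; the second half is
`refCoreStmt_holds`). [cite: MochizukiAbsTopIII2015, Cor 3.7 (i) p.87] -/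
theorem cor_3_7_i_holds : 𝔖.Cor_3_7_i := ⟨𝔖.galoisCoreStmt_holds, 𝔖.refCoreStmt_holds⟩

/-! ## Cor 3.7 (ii), last sentence: `𝔈` forms a core of `𝒟*` -/

/-- The augmentation of `𝒟*_{≤3}` towards `𝔈` as a `CoreAugmentation` of the extension datum
`(𝒟*, 𝔈)`. [cite: MochizukiAbsTopIII2015, Cor 3.7 (ii) p.88] -/
def starGalCoreAugmentation : (𝔖.starLe 3).CoreAugmentation 𝔖.starGalCoreExt where
  isEmpty_J _ := inferInstanceAs (IsEmpty PEmpty)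
  aug a := 𝔖.starAug a.1
  iso e := 𝔖.starAugIso e
  obsIso {a} i := match a, i with
    | ⟨.space, _⟩, _ => Iso.refl _
    | ⟨.first _, _⟩, i => PEmpty.elim i
    | ⟨.box, _⟩, i => PEmpty.elim i
    | ⟨.galois, _⟩, i => PEmpty.elim i
    | ⟨.ref, _⟩, i => PEmpty.elim i

/-- Every vertex of `𝒟*_{≤3}` reaches `𝔈` (`⋎ → □ → 𝒩 → 𝔈`, and the core vertex via `δ_□`).
[cite: MochizukiAbsTopIII2015, Cor 3.7 (ii) p.88] -/
theorem starGalCore_reaches (a : SubVertex {a : Cor37Vertex | a.row ≤ 3}) :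
    Nonempty (Path (starGalCoreShape.{u}.base a) starGalCoreShape.{u}.obs) := by
  obtain ⟨a, ha⟩ := a
  have hbox : (Cor37Vertex.box : Cor37Vertex).row ≤ 3 := by decide
  have hsp : (Cor37Vertex.space : Cor37Vertex).row ≤ 3 := by decide
  have tail : Path (starGalCoreShape.{u}.base ⟨.box, hbox⟩) starGalCoreShape.{u}.obs :=
    ((Path.nil : Path (starGalCoreShape.{u}.base ⟨.box, hbox⟩) _).cons
      (show starGalCoreShape.{u}.base ⟨.box, hbox⟩ ⟶ starGalCoreShape.{u}.base ⟨.space, hsp⟩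
        from Cor37Edge.lamTimes)).cons
      (show starGalCoreShape.{u}.base ⟨.space, hsp⟩ ⟶ starGalCoreShape.{u}.obs from PUnit.unit)
  cases a with
  | first n =>
    exact ⟨((Path.nil : Path (starGalCoreShape.{u}.base ⟨.first n, ha⟩) _).cons
      (show starGalCoreShape.{u}.base ⟨.first n, ha⟩ ⟶ starGalCoreShape.{u}.base ⟨.box, hbox⟩
        from Cor37Edge.pr n)).comp tail⟩
  | box => exact ⟨tail⟩
  | space => exact ⟨(Path.nil : Path (starGalCoreShape.{u}.base ⟨.space, ha⟩) _).cons
      (show starGalCoreShape.{u}.base ⟨.space, ha⟩ ⟶ starGalCoreShape.{u}.obs from PUnit.unit)⟩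
  | galois => exact False.elim (by simp [Cor37Vertex.row] at ha)
  | ref =>
    exact ⟨((Path.nil : Path (starGalCoreShape.{u}.base ⟨.ref, ha⟩) _).cons
      (show starGalCoreShape.{u}.base ⟨.ref, ha⟩ ⟶ starGalCoreShape.{u}.base ⟨.box, hbox⟩
        from Cor37Edge.diagBox)).comp tail⟩

/-- **Cor 3.7 (ii), last sentence, DISCHARGED** for every setting: "`𝔈` 'forms a core' of the
functors in `𝒟*`". [cite: MochizukiAbsTopIII2015, Cor 3.7 (ii) p.88] -/
theorem starGaloisCoreStmt_holds : 𝔖.StarGaloisCoreStmt :=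
  ⟨𝔖.starGalCoreAugmentation.coreFamily, 𝔖.starGalCoreAugmentation.coreFamily_terminal,
    𝔖.starGalCoreAugmentation.coreObservable_isCore starGalCore_reaches⟩

/-- Hence Cor 3.7 (ii) reduces to the telecore and `ℋ_δ` statements.
[cite: MochizukiAbsTopIII2015, Cor 3.7 (ii) p.88] -/
theorem cor_3_7_ii_iff (θ : FiberSquare.BiAnabelianLift 𝔖.gal) :
    𝔖.Cor_3_7_ii θ ↔ 𝔖.TelecoreDeltaStmt θ ∧ 𝔖.DeltaFamilyStmt θ :=
  ⟨fun h => ⟨h.1, h.2.1⟩, fun h => ⟨h.1, h.2, 𝔖.starGaloisCoreStmt_holds⟩⟩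

end BiAnabelianSetting

end Literature.AnabelianGeometry.AbsoluteAnabelian.AbsTopIII
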